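import Summits.QuantumFields.QCD.Theses.NestedDissectionSea
import Literature.Barriers.QuantumFields.WilsonDeterminantSign
import Literature.MathematicalPhysics.QuantumLattice.OverlapLocality

/-!
# Stub `stub_quarantineIdentity` of line `proper-time-quarantine`
(crux `Summit.QuantumFields.QCD.Theses.NestedDissectionSea.SeaFactorisationBridge`, item stmt-QuantumFields-13880)

Matrix quarantine identity for the Wilson determinant GIVEN the scalar Frullani toolkit:
`‖det D_W‖ = e^{F+(n/2)E₁(t₀)}·e^{−W}` off the zero locus, `|g| ≤ 1`, `W ≥ 0`, log-bounded `F`.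

## Proof

Let `H = Γ₅ D_W(U, μ, 1)` (Hermitian, real eigenvalues `λ_i`); `det D_W = ∏ λ_i`
(`fermionDet_wilsonDirac_eq_prod_eigenvalues`), so `‖det D_W‖ = ∏ |λ_i|`.
* (a) Off the zero locus every `λ_i ≠ 0`; the toolkit at `lam = λ_i² > 0` gives
  `2 log|λ_i| = log λ_i² = uv(λ_i²) − E₁(t₀λ_i²) + E₁(t₀)`, and `∏|λ_i| = exp Σ log|λ_i|`.
* (b) `|Re det| ≤ ‖det‖`, then (a) and (c) give `|Re det| e^{−F−(n/2)E₁} = e^{−W} ≤ 1`.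
* (c) the integrand `e^{-s}/s` is non-negative on `(t₀λ_i², ∞) ⊆ [0, ∞)`.
* (d) `|uv(λ_i²)| ≤ 4 + log(1+λ_i²) + log t₀` (toolkit) and `|λ_i| ≤ ‖H‖ ≤ ‖Γ₅‖‖D_W‖ ≤ |μ+4|+4`
  (C⋆-identity for `Γ₅² = 1`, HJL bound `l2_opNorm_wilsonDirac_le`, Rayleigh on a normalised
  eigenvector), so `1 + λ_i² ≤ (|μ+4|+5)²` and `log(1+λ_i²) ≤ 2 log(|μ+4|+5)`.
-/

noncomputable section

namespace Summit.QuantumFields.QCD.Cruxes.SeaFactorisationBridge.ProperTimeQuarantine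

open scoped BigOperators Topology Classical MeasureTheory Matrix ComplexConjugate ComplexOrder
open Filter MeasureTheory
open Literature.MathematicalPhysics.QuantumFieldTheory Literature.MathematicalPhysics.QuantumLattice
open Literature.Probability.LatticeModels

section Helpers

open scoped Matrix.Norms.L2Operator
open Literature.Barriers.QuantumFields.WilsonDeterminant

variable {L Nc : ℕ} [NeZero L] {G : Type*} [Group G] (ρ : G →* Matrix (Fin Nc) (Fin Nc) ℂ)

/-- `‖1‖ ≤ 1` for the identity matrix in the `ℓ²` operator norm. -/
private theorem l2_opNorm_one_le :
    ‖(1 : Matrix (TorusSite 4 L × Fin Nc × Fin 4) (TorusSite 4 L × Fin Nc × Fin 4) ℂ)‖ ≤ 1 := by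
  rw [Matrix.cstar_norm_def, map_one]
  exact ContinuousLinearMap.norm_id_le

/-- `‖Γ₅‖ ≤ 1` in the `ℓ²` operator norm: `Γ₅ᴴ Γ₅ = Γ₅² = 1` and the C⋆-identity. -/
private theorem l2_opNorm_spinorLift_gammaFive_le :
    ‖(spinorLift gammaFive :
        Matrix (TorusSite 4 L × Fin Nc × Fin 4) (TorusSite 4 L × Fin Nc × Fin 4) ℂ)‖ ≤ 1 := by
  set Γ : Matrix (TorusSite 4 L × Fin Nc × Fin 4) (TorusSite 4 L × Fin Nc × Fin 4) ℂ :=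
    spinorLift gammaFive with hΓ
  have hsq : ‖Γ‖ * ‖Γ‖ ≤ 1 := by
    rw [← CStarRing.norm_star_mul_self, Matrix.star_eq_conjTranspose, hΓ,
      conjTranspose_spinorLift_gammaFive, spinorLift_gammaFive_mul_self]
    exact l2_opNorm_one_le
  nlinarith [norm_nonneg Γ]

/-- `‖Γ₅ D_W(U, m, 1)‖ ≤ |m + 4| + 4` in the `ℓ²` operator norm. -/
private theorem l2_opNorm_hermitianWilsonDirac_le
    (hρ : ∀ g, ρ g ∈ Matrix.unitaryGroup (Fin Nc) ℂ) (U : GaugeConfig 4 L G) (m : ℝ) :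
    ‖hermitianWilsonDirac ρ U m 1‖ ≤ |m + 4| + 4 := by
  unfold hermitianWilsonDirac
  calc ‖spinorLift gammaFive * wilsonDirac ρ U m 1‖
      ≤ ‖(spinorLift gammaFive :
            Matrix (TorusSite 4 L × Fin Nc × Fin 4) (TorusSite 4 L × Fin Nc × Fin 4) ℂ)‖ *
          ‖wilsonDirac ρ U m 1‖ := Matrix.l2_opNorm_mul _ _
    _ ≤ 1 * (|m + 4| + 4) :=
        mul_le_mul l2_opNorm_spinorLift_gammaFive_le (l2_opNorm_wilsonDirac_le ρ hρ U m)
          (norm_nonneg _) zero_le_one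
    _ = |m + 4| + 4 := one_mul _

/-- **Eigenvalue bound** `|λ_i(Γ₅ D_W(U, m, 1))| ≤ |m + 4| + 4`: Rayleigh quotient on the
normalised eigenvector `v_i`, `λ_i² = Σ_j ‖(H v_i)_j‖² ≤ ‖H‖² Σ_j ‖(v_i)_j‖² = ‖H‖²`. -/
private theorem abs_eigenvalues_le (hρ : ∀ g, ρ g ∈ Matrix.unitaryGroup (Fin Nc) ℂ)
    (U : GaugeConfig 4 L G) (m : ℝ) (i : TorusSite 4 L × Fin Nc × Fin 4) :
    |(isHermitian_hermitianWilsonDirac ρ hρ U m 1).eigenvalues i| ≤ |m + 4| + 4 := by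
  set hA := isHermitian_hermitianWilsonDirac ρ hρ U m 1
  set v := hA.eigenvectorBasis i with hv_def
  have hv : hermitianWilsonDirac ρ U m 1 *ᵥ ⇑v = hA.eigenvalues i • ⇑v :=
    hA.mulVec_eigenvectorBasis i
  have hnorm : ‖v‖ = 1 := hA.eigenvectorBasis.orthonormal.1 i
  have hS : ∑ j, ‖v j‖ ^ 2 = 1 := by rw [← EuclideanSpace.norm_sq_eq, hnorm, one_pow]
  have hle := sum_norm_sq_mulVec_le (hermitianWilsonDirac ρ U m 1) (⇑v)
  rw [hv, hS, mul_one] at hle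
  have hlhs : ∑ j, ‖(hA.eigenvalues i • ⇑v) j‖ ^ 2 = (hA.eigenvalues i) ^ 2 := by
    have : ∀ j, ‖(hA.eigenvalues i • ⇑v) j‖ ^ 2 = (hA.eigenvalues i) ^ 2 * ‖v j‖ ^ 2 := by
      intro j
      rw [Pi.smul_apply, norm_smul, mul_pow, Real.norm_eq_abs, sq_abs]
    rw [Finset.sum_congr rfl fun j _ => this j, ← Finset.mul_sum, hS, mul_one]
  rw [hlhs] at hle
  exact (abs_le_of_sq_le_sq hle (norm_nonneg _)).trans
    (l2_opNorm_hermitianWilsonDirac_le ρ hρ U m)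

/-- `‖det D_W‖ = ∏_i |λ_i|` (`det D_W = ∏ λ_i` over the real spectrum of `Γ₅ D_W`). -/
private theorem norm_fermionDet_eq_prod_abs (hρ : ∀ g, ρ g ∈ Matrix.unitaryGroup (Fin Nc) ℂ)
    (U : GaugeConfig 4 L G) (m r : ℝ) :
    ‖fermionDet (wilsonDirac ρ U m r)‖ =
      ∏ i, |(isHermitian_hermitianWilsonDirac ρ hρ U m r).eigenvalues i| := by
  rw [fermionDet_wilsonDirac_eq_prod_eigenvalues ρ hρ U m r, norm_prod]
  refine Finset.prod_congr rfl fun i _ => ?_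
  rw [Complex.norm_real, Real.norm_eq_abs]

/-- Off the zero locus of `det D_W` no eigenvalue of `Γ₅ D_W` vanishes. -/
private theorem eigenvalues_ne_zero (hρ : ∀ g, ρ g ∈ Matrix.unitaryGroup (Fin Nc) ℂ)
    (U : GaugeConfig 4 L G) (m r : ℝ) (hdet : fermionDet (wilsonDirac ρ U m r) ≠ 0)
    (i : TorusSite 4 L × Fin Nc × Fin 4) :
    (isHermitian_hermitianWilsonDirac ρ hρ U m r).eigenvalues i ≠ 0 := by
  intro hi
  apply hdet
  rw [fermionDet_wilsonDirac_eq_prod_eigenvalues ρ hρ U m r]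
  exact Finset.prod_eq_zero (Finset.mem_univ i) (by rw [hi]; simp)

/-- Scalar step of (a): `log λ² = r`, `λ ≠ 0` ⇒ `|λ| = e^{r/2}`. -/
private theorem abs_eq_exp_half {lam r : ℝ} (hlam : lam ≠ 0) (h : Real.log (lam ^ 2) = r) :
    |lam| = Real.exp (r / 2) := by
  rw [← Real.exp_log (abs_pos.mpr hlam), Real.log_abs]
  congr 1
  rw [Real.log_pow] at h
  push_cast at h
  linarith

/-- Scalar step of (d): `|λ| ≤ a + 4`, `0 ≤ a` ⇒ `log(1 + λ²) ≤ 2 log(a + 5)`. -/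
private theorem log_one_add_sq_le {lam a : ℝ} (ha : 0 ≤ a) (h : |lam| ≤ a + 4) :
    Real.log (1 + lam ^ 2) ≤ 2 * Real.log (a + 5) := by
  have h1 : lam ^ 2 ≤ (a + 4) ^ 2 := by
    rw [← sq_abs]
    exact pow_le_pow_left₀ (abs_nonneg _) h 2
  have h2 : 1 + lam ^ 2 ≤ (a + 5) ^ 2 := by nlinarith
  have h3 : (0 : ℝ) < 1 + lam ^ 2 := by positivity
  calc Real.log (1 + lam ^ 2) ≤ Real.log ((a + 5) ^ 2) := Real.log_le_log h3 h2
    _ = 2 * Real.log (a + 5) := by rw [Real.log_pow]; norm_num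

/-- Scalar step of (c): `0 ≤ ∫_x^∞ e^{-s}/s ds` for `0 ≤ x` (non-negative integrand on the
domain; no integrability needed). -/
private theorem expIntegral_nonneg {x : ℝ} (hx : 0 ≤ x) :
    0 ≤ ∫ s in Set.Ioi x, Real.exp (-s) / s :=
  setIntegral_nonneg measurableSet_Ioi fun _ hs =>
    div_nonneg (Real.exp_pos _).le (hx.trans (le_of_lt (Set.mem_Ioi.mp hs)))

end Helpers

/-- **Quarantine identity** (registered stub `stub_quarantineIdentity`), given the Frullani toolkit as hypothesis. -/
theorem stub_quarantineIdentity :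
    ((∀ t₀ lam : ℝ, 0 < t₀ → 0 < lam →
        Real.log lam =
          (-∫ t in Set.Ioc 0 t₀, (Real.exp (-(t * lam)) - Real.exp (-t)) / t) -
            (∫ s in Set.Ioi (t₀ * lam), Real.exp (-s) / s) + ∫ s in Set.Ioi t₀, Real.exp (-s) / s) ∧
      (∀ x : ℝ, 0 < x →
        0 ≤ ∫ s in Set.Ioi x, Real.exp (-s) / s ∧
          ∫ s in Set.Ioi x, Real.exp (-s) / s ≤ Real.exp (-x) / x) ∧
      (∀ t₀ lam : ℝ, 0 < t₀ → 0 ≤ lam →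
        |(-∫ t in Set.Ioc 0 t₀, (Real.exp (-(t * lam)) - Real.exp (-t)) / t)| ≤ t₀ * |lam - 1|) ∧
      (∀ t₀ lam : ℝ, 1 ≤ t₀ → 0 ≤ lam →
        |(-∫ t in Set.Ioc 0 t₀, (Real.exp (-(t * lam)) - Real.exp (-t)) / t)| ≤
          4 + Real.log (1 + lam) + Real.log t₀)) →
    ∀ (N : ℕ) [NeZero N] (U : GaugeConfig 4 N (Matrix.specialUnitaryGroup (Fin 3) ℂ)) (μ t₀ : ℝ), 0 < t₀ →
      let ev : TorusSite 4 N × Fin 3 × Fin 4 → ℝ := (Literature.Barriers.QuantumFields.WilsonDeterminant.isHermitian_hermitianWilsonDirac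
          (fundamentalRep (Fin 3)) fundamentalRep_mem_unitaryGroup U μ 1).eigenvalues
      let n : ℝ := Fintype.card (TorusSite 4 N × Fin 3 × Fin 4)
      let E₁ : ℝ → ℝ := fun x => ∫ s in Set.Ioi x, Real.exp (-s) / s
      let uv : ℝ → ℝ := fun lam => -∫ t in Set.Ioc 0 t₀, (Real.exp (-(t * lam)) - Real.exp (-t)) / t
      let F : ℝ := (1 / 2) * ∑ i, uv (ev i ^ 2)
      let W : ℝ := (1 / 2) * ∑ i, E₁ (t₀ * ev i ^ 2)
      (fermionDet (wilsonDirac (fundamentalRep (Fin 3)) U μ 1) ≠ 0 →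
          ‖fermionDet (wilsonDirac (fundamentalRep (Fin 3)) U μ 1)‖ =
            Real.exp (F + n / 2 * E₁ t₀) * Real.exp (-W)) ∧
        |(fermionDet (wilsonDirac (fundamentalRep (Fin 3)) U μ 1)).re * Real.exp (-F - n / 2 * E₁ t₀)| ≤ 1 ∧
        0 ≤ W ∧
        (1 ≤ t₀ → |F| ≤ n / 2 * (4 + 2 * Real.log (|μ + 4| + 5) + Real.log t₀)) := by
  intro htk N _ U μ t₀ ht₀ ev n E₁ uv F W
  obtain ⟨hlog, -, -, huv⟩ := htk
  have hF : F = 1 / 2 * ∑ i, uv (ev i ^ 2) := rfl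
  have hWdef : W = 1 / 2 * ∑ i, E₁ (t₀ * ev i ^ 2) := rfl
  have hn : n = (Fintype.card (TorusSite 4 N × Fin 3 × Fin 4) : ℝ) := rfl
  -- (c) `0 ≤ W`
  have hW : 0 ≤ W := by
    rw [hWdef]
    refine mul_nonneg (by norm_num) (Finset.sum_nonneg fun i _ => ?_)
    exact expIntegral_nonneg (by positivity)
  -- (a) the norm identity off the zero locus
  have hnormD : ‖fermionDet (wilsonDirac (fundamentalRep (Fin 3)) U μ 1)‖ = ∏ i, |ev i| :=
    norm_fermionDet_eq_prod_abs _ fundamentalRep_mem_unitaryGroup U μ 1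
  have hA : fermionDet (wilsonDirac (fundamentalRep (Fin 3)) U μ 1) ≠ 0 →
      ‖fermionDet (wilsonDirac (fundamentalRep (Fin 3)) U μ 1)‖ =
        Real.exp (F + n / 2 * E₁ t₀) * Real.exp (-W) := by
    intro hdet
    have hne : ∀ i, ev i ≠ 0 := fun i =>
      eigenvalues_ne_zero _ fundamentalRep_mem_unitaryGroup U μ 1 hdet i
    have hexp : ∀ i, |ev i| = Real.exp ((uv (ev i ^ 2) - E₁ (t₀ * ev i ^ 2) + E₁ t₀) / 2) := by
      intro i
      have hi := hne i
      have hpos : 0 < ev i ^ 2 := by positivity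
      exact abs_eq_exp_half hi (hlog t₀ (ev i ^ 2) ht₀ hpos)
    rw [hnormD, ← Real.exp_add, Finset.prod_congr rfl fun i _ => hexp i, ← Real.exp_sum]
    congr 1
    rw [hF, hWdef, hn, ← Finset.sum_div, Finset.sum_add_distrib, Finset.sum_sub_distrib,
      Finset.sum_const, Finset.card_univ, nsmul_eq_mul]
    ring
  -- (b) the edge factor is bounded by one
  have hB : |(fermionDet (wilsonDirac (fundamentalRep (Fin 3)) U μ 1)).re *
      Real.exp (-F - n / 2 * E₁ t₀)| ≤ 1 := by
    by_cases hdet : fermionDet (wilsonDirac (fundamentalRep (Fin 3)) U μ 1) = 0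
    · rw [hdet, Complex.zero_re, zero_mul, abs_zero]
      exact zero_le_one
    · rw [abs_mul, abs_of_pos (Real.exp_pos _)]
      calc |(fermionDet (wilsonDirac (fundamentalRep (Fin 3)) U μ 1)).re| *
            Real.exp (-F - n / 2 * E₁ t₀)
          ≤ ‖fermionDet (wilsonDirac (fundamentalRep (Fin 3)) U μ 1)‖ *
            Real.exp (-F - n / 2 * E₁ t₀) :=
            mul_le_mul_of_nonneg_right (Complex.abs_re_le_norm _) (Real.exp_pos _).le
        _ = Real.exp (-W) := by
            rw [hA hdet, mul_comm (Real.exp _) (Real.exp (-W)), mul_assoc, ← Real.exp_add]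
            have h0 : F + n / 2 * E₁ t₀ + (-F - n / 2 * E₁ t₀) = 0 := by ring
            rw [h0, Real.exp_zero, mul_one]
        _ ≤ 1 := Real.exp_le_one_iff.mpr (by linarith)
  -- (d) the `log`-bound on `F`
  have hD : 1 ≤ t₀ → |F| ≤ n / 2 * (4 + 2 * Real.log (|μ + 4| + 5) + Real.log t₀) := by
    intro ht1
    have hbound : ∀ i, |uv (ev i ^ 2)| ≤ 4 + 2 * Real.log (|μ + 4| + 5) + Real.log t₀ := by
      intro i
      have h1 : |uv (ev i ^ 2)| ≤ 4 + Real.log (1 + ev i ^ 2) + Real.log t₀ :=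
        huv t₀ (ev i ^ 2) ht1 (sq_nonneg _)
      have h2 : Real.log (1 + ev i ^ 2) ≤ 2 * Real.log (|μ + 4| + 5) :=
        log_one_add_sq_le (abs_nonneg _)
          (abs_eigenvalues_le _ fundamentalRep_mem_unitaryGroup U μ i)
      linarith
    rw [hF, abs_mul, abs_of_pos (by norm_num : (0 : ℝ) < 1 / 2)]
    calc 1 / 2 * |∑ i, uv (ev i ^ 2)| ≤ 1 / 2 * ∑ i, |uv (ev i ^ 2)| :=
          mul_le_mul_of_nonneg_left (Finset.abs_sum_le_sum_abs _ _) (by norm_num)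
      _ ≤ 1 / 2 * ∑ _i : TorusSite 4 N × Fin 3 × Fin 4,
            (4 + 2 * Real.log (|μ + 4| + 5) + Real.log t₀) :=
          mul_le_mul_of_nonneg_left (Finset.sum_le_sum fun i _ => hbound i) (by norm_num)
      _ = n / 2 * (4 + 2 * Real.log (|μ + 4| + 5) + Real.log t₀) := by
          rw [Finset.sum_const, Finset.card_univ, nsmul_eq_mul, hn]
          ring
  exact ⟨hA, hB, hW, hD⟩

end Summit.QuantumFields.QCD.Cruxes.SeaFactorisationBridge.ProperTimeQuarantine

end
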